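/-
Companion file of the Resolution Observatory cell (pub-rosobs), carver generation 47.  Statements OURS (the cell's
LEMMA LD, engine 1 generation 31); pure commutative algebra over an arbitrary commutative ring.  An INSTRUMENT of the
cell's normal-form bookkeeping for maximal weighted centres — NOT a resolution theorem.
-/
import Mathlib.Algebra.MvPolynomial.PDeriv
import Mathlib.Algebra.Polynomial.Coeff
import Mathlib.Algebra.Order.BigOperators.Group.Multiset
import HarnessLib

/-!
# Clean layers are derivations (LEMMA LD of the weighted-centre normal-form algorithm)

Let `A = R[ε_i : i ∈ ι]` and let `Φ : ε_i ↦ ε_i + Δ_i(σ)` be a substitution whose shifts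
`Δ_i = Σ_{t ≥ 1} σ^t · a_{t,i}` (`a_{t,i} ∈ A`) have NO layer `0`.  Group the shift by LAYERS
`a_t = (a_{t,i})_i` and call `t` a LAYER INDEX when `a_t ≠ 0`.  For `g ∈ A` write
`g(ε + Δ) = Σ_s σ^s · c_s(g)`.  The Taylor expansion with Hasse differential operators,
`g(ε + ρ) = Σ_A (D_A g) ρ^A` [Hironaka1970AdditiveGroups, (1.2)], [CossartJannsenSaito2020, Ch. 14, proof of
Lemma 14.10], shows that `c_s(g)` only involves products of layers whose indices SUM to `s`.  Call `s` CLEAN when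
`s` is not a sum of two or more layer indices (repetitions allowed).  In a clean layer only `|A| = 1` survives:

  `c_s(g) = L_s(g) := Σ_i a_{s,i} · ∂g/∂ε_i`   (`s ≥ 1` clean),     `c_0(g) = g`,

so in a clean layer `Φ` acts through the DERIVATION `L_s` of `A`; in particular `g ∘ Φ = g` forces `L_s(g) = 0`
for every clean `s ≥ 1`.  This is the identity behind the PURGE step of the cell's normal-form algorithm for
maximal weighted centres (engine 1, generations 30–31: purging the inessential `y_r`-dependence of a centre layer
by layer).  It is proved here over ANY commutative ring and any index type, by induction on `g` — no Taylor formula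
and no division by factorials: the `σ`-support of `g(ε + Δ)` lies in the additive monoid generated by the layer
indices (`exists_multiset_of_coeff_layerSubst_ne_zero`), and cleanness kills every cross term of a product.

## Main statements

* `layerSubst Δ : A →ₐ[R] A[σ]`, `g ↦ g(ε + Δ)`; `IsLayerIndex Δ t`; `IsCleanLayer Δ s`;
  `layerDeriv Δ s g = Σ_i a_{s,i} ∂_i g` with `layerDeriv_mul` (Leibniz).
* `coeff_zero_layerSubst`: `c_0(g) = g`.
* `exists_multiset_of_coeff_layerSubst_ne_zero`: `c_s(g) ≠ 0 ⇒ s` is a (possibly empty) sum of layer indices.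
* `coeff_layerSubst_of_isCleanLayer` (LEMMA LD): `c_s(g) = [s = 0]·g + L_s(g)` for clean `s`;
  `coeff_layerSubst_eq_layerDeriv` (`s ≠ 0`); `layerDeriv_eq_zero_of_layerSubst_eq` (`g ∘ Φ = g ⇒ L_s g = 0`).
* `isCleanLayer_of_lt_two_mul`: every `s < 2·(least layer index)` is clean — in particular the bottom layer;
  `coeff_layerSubst_monomial`: for a one-layer shift `Δ_i = σ^d a_i` (`d ≥ 1`) the `σ^d`-coefficient of
  `g(ε + σ^d a)` is the directional derivative `Σ_i a_i ∂_i g`.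
* Sharpness of "clean": for `g = ε_0 ε_1`, `Δ_0 = Δ_1 = σ` the layer `2 = 1 + 1` is not clean and indeed
  `c_2(g) = 1 ≠ 0 = L_2(g)` (`coeff_two_layerSubst_X_mul_X`, `layerDeriv_two_X_mul_X`).
-/

noncomputable section

open MvPolynomial

namespace Literature.AlgebraicGeometry.Resolution.WeightedBlowup

variable {R : Type*} [CommRing R] {ι : Type*}

/-- The substitution `g ↦ g(ε + Δ)`: `ε_i ↦ ε_i + Δ_i(σ)`, valued in `A[σ]`, `A = MvPolynomial ι R`
(`σ = Polynomial.X`) — the map `G ↦ G(X + ρ)` specialised to `ρ = Δ(σ)`. (model)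
[cite: CossartJannsenSaito2020, Ch. 14, proof of Lemma 14.10 (p. 170) (Hasse derivations `D_A`: `G(X+ρ) = Σ_A D_A G·ρ^A`)] -/
def layerSubst (Δ : ι → Polynomial (MvPolynomial ι R)) :
    MvPolynomial ι R →ₐ[R] Polynomial (MvPolynomial ι R) :=
  aeval fun i => Polynomial.C (X i) + Δ i

/-- `t` is a LAYER INDEX of the shift `Δ`: the layer `a_t = (σ^t-coefficient of Δ_i)_i` is non-zero.
(model: the cell's LEMMA LD, engine 1 gen 31)
[cite: CossartJannsenSaito2020, Ch. 14, proof of Lemma 14.10 (p. 170)] -/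
def IsLayerIndex (Δ : ι → Polynomial (MvPolynomial ι R)) (t : ℕ) : Prop :=
  ∃ i, (Δ i).coeff t ≠ 0

/-- `s` is a CLEAN layer: `s` is not a sum of two or more layer indices (with repetition), i.e. every
multiset of layer indices summing to `s` has at most one element. (model: the cell's LEMMA LD)
[cite: CossartJannsenSaito2020, Ch. 14, proof of Lemma 14.10 (p. 170)] -/
def IsCleanLayer (Δ : ι → Polynomial (MvPolynomial ι R)) (s : ℕ) : Prop :=
  ∀ T : Multiset ℕ, (∀ t ∈ T, IsLayerIndex Δ t) → T.sum = s → Multiset.card T ≤ 1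

/-- The layer derivation `L_s(g) = Σ_i a_{s,i} · ∂g/∂ε_i` — the `|A| = 1` part of `Σ_A D_A g · Δ^A` in
`σ`-degree `s`. (model)
[cite: CossartJannsenSaito2020, Ch. 14, proof of Lemma 14.10 (p. 170) (Hasse derivations `D_A`: `G(X+ρ) = Σ_A D_A G·ρ^A`)] -/
def layerDeriv [Fintype ι] (Δ : ι → Polynomial (MvPolynomial ι R)) (s : ℕ) (g : MvPolynomial ι R) :
    MvPolynomial ι R :=
  ∑ i, (Δ i).coeff s * pderiv i g

section Subst

variable (Δ : ι → Polynomial (MvPolynomial ι R))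

/-- Constants are fixed: `c(ε + Δ) = c`. (plumbing, derived here)
[cite: CossartJannsenSaito2020, Ch. 14, proof of Lemma 14.10 (p. 170)] -/
@[simp] theorem layerSubst_C (a : R) : layerSubst Δ (C a) = Polynomial.C (C a) := by
  rw [layerSubst, aeval_C, Polynomial.algebraMap_apply, MvPolynomial.algebraMap_eq]

/-- `ε_i ↦ ε_i + Δ_i`. (plumbing, derived here)
[cite: CossartJannsenSaito2020, Ch. 14, proof of Lemma 14.10 (p. 170)] -/
@[simp] theorem layerSubst_X (i : ι) : layerSubst Δ (X i) = Polynomial.C (X i) + Δ i := by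
  rw [layerSubst, aeval_X]

/-- `c_0(g) = g` when the shift has no layer `0` (the `A = 0` term of the Taylor expansion). (derived here)
[cite: CossartJannsenSaito2020, Ch. 14, proof of Lemma 14.10 (p. 170)] -/
theorem coeff_zero_layerSubst (h0 : ∀ i, (Δ i).coeff 0 = 0) (g : MvPolynomial ι R) :
    (layerSubst Δ g).coeff 0 = g := by
  induction g using MvPolynomial.induction_on with
  | C a => rw [layerSubst_C, Polynomial.coeff_C_zero]
  | add p q hp hq => rw [map_add, Polynomial.coeff_add, hp, hq]
  | mul_X p j hp =>
    rw [map_mul, Polynomial.mul_coeff_zero, hp, layerSubst_X, Polynomial.coeff_add,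
      Polynomial.coeff_C_zero, h0, add_zero]

/-- SUPPORT: if the `σ^s`-coefficient of `g(ε + Δ)` is non-zero then `s` is a sum of layer indices
(the empty sum for `s = 0`) — the `σ`-exponents of `Δ^A` are sums of `|A|` layer indices. (derived here)
[cite: CossartJannsenSaito2020, Ch. 14, proof of Lemma 14.10 (p. 170)] -/
theorem exists_multiset_of_coeff_layerSubst_ne_zero (g : MvPolynomial ι R) {s : ℕ}
    (h : (layerSubst Δ g).coeff s ≠ 0) :
    ∃ T : Multiset ℕ, (∀ t ∈ T, IsLayerIndex Δ t) ∧ T.sum = s := by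
  induction g using MvPolynomial.induction_on generalizing s with
  | C a =>
    refine ⟨0, fun t ht => absurd ht (Multiset.notMem_zero t), ?_⟩
    rw [layerSubst_C, Polynomial.coeff_C] at h
    rw [Multiset.sum_zero]
    by_contra hs
    exact h (if_neg fun h' => hs h'.symm)
  | add p q hp hq =>
    rw [map_add, Polynomial.coeff_add] at h
    by_cases hp0 : (layerSubst Δ p).coeff s = 0
    · rw [hp0, zero_add] at h
      exact hq h
    · exact hp hp0
  | mul_X p j hp =>
    rw [map_mul, layerSubst_X, Polynomial.coeff_mul] at h
    obtain ⟨⟨a, b⟩, hab, hne⟩ := Finset.exists_ne_zero_of_sum_ne_zero h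
    rw [Finset.mem_antidiagonal] at hab
    dsimp only at hab hne
    obtain ⟨T, hT, hTs⟩ := hp (left_ne_zero_of_mul hne)
    have hb := right_ne_zero_of_mul hne
    rw [Polynomial.coeff_add, Polynomial.coeff_C] at hb
    by_cases hb0 : b = 0
    · subst hb0
      exact ⟨T, hT, by rw [hTs]; omega⟩
    · rw [if_neg hb0, zero_add] at hb
      refine ⟨b ::ₘ T, fun t ht => ?_, by rw [Multiset.sum_cons, hTs]; omega⟩
      rcases Multiset.mem_cons.1 ht with rfl | ht
      · exact ⟨j, hb⟩
      · exact hT t ht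

end Subst

section Deriv

variable [Fintype ι] (Δ : ι → Polynomial (MvPolynomial ι R)) (s : ℕ)

/-- `L_s(c) = 0` for constants. (plumbing, derived here)
[cite: CossartJannsenSaito2020, Ch. 14, proof of Lemma 14.10 (p. 170)] -/
theorem layerDeriv_C (a : R) : layerDeriv Δ s (C a) = 0 := by
  simp only [layerDeriv, pderiv_C, mul_zero, Finset.sum_const_zero]

/-- `L_s` is additive. (plumbing, derived here)
[cite: CossartJannsenSaito2020, Ch. 14, proof of Lemma 14.10 (p. 170)] -/
theorem layerDeriv_add (p q : MvPolynomial ι R) :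
    layerDeriv Δ s (p + q) = layerDeriv Δ s p + layerDeriv Δ s q := by
  simp only [layerDeriv, map_add, mul_add, Finset.sum_add_distrib]

/-- `L_s(ε_j) = a_{s,j}`. (plumbing, derived here)
[cite: CossartJannsenSaito2020, Ch. 14, proof of Lemma 14.10 (p. 170)] -/
theorem layerDeriv_X (j : ι) : layerDeriv Δ s (X j) = (Δ j).coeff s := by
  classical
  rw [layerDeriv, Finset.sum_eq_single j]
  · rw [pderiv_X_self, mul_one]
  · intro i _ hij
    rw [pderiv_X_of_ne (Ne.symm hij), mul_zero]
  · intro h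
    exact absurd (Finset.mem_univ j) h

/-- `L_s` is a derivation (Leibniz rule). (derived here)
[cite: CossartJannsenSaito2020, Ch. 14, proof of Lemma 14.10 (p. 170)] -/
theorem layerDeriv_mul (p q : MvPolynomial ι R) :
    layerDeriv Δ s (p * q) = layerDeriv Δ s p * q + p * layerDeriv Δ s q := by
  simp only [layerDeriv, Derivation.leibniz, smul_eq_mul]
  rw [Finset.sum_mul, Finset.mul_sum, ← Finset.sum_add_distrib]
  exact Finset.sum_congr rfl fun i _ => by ring

/-- Leibniz against a variable: `L_s(p·ε_j) = L_s(p)·ε_j + a_{s,j}·p`. (plumbing, derived here)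
[cite: CossartJannsenSaito2020, Ch. 14, proof of Lemma 14.10 (p. 170)] -/
theorem layerDeriv_mul_X (p : MvPolynomial ι R) (j : ι) :
    layerDeriv Δ s (p * X j) = layerDeriv Δ s p * X j + (Δ j).coeff s * p := by
  rw [layerDeriv_mul, layerDeriv_X, mul_comm p]

/-- No layer `0` ⇒ `L_0 = 0`. (plumbing, derived here)
[cite: CossartJannsenSaito2020, Ch. 14, proof of Lemma 14.10 (p. 170)] -/
theorem layerDeriv_zero (h0 : ∀ i, (Δ i).coeff 0 = 0) (g : MvPolynomial ι R) : layerDeriv Δ 0 g = 0 := by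
  simp only [layerDeriv, h0, zero_mul, Finset.sum_const_zero]

end Deriv

section Main

variable [Fintype ι] {Δ : ι → Polynomial (MvPolynomial ι R)}

/-- **LEMMA LD (clean layers are derivations).**  If the shift `Δ` has no layer `0` and `s` is a clean
layer, then the `σ^s`-coefficient of `g(ε + Δ)` is `[s = 0]·g + Σ_i a_{s,i} ∂_i g` for every `g`: in the Taylor
expansion `Σ_A D_A g · Δ^A` only `|A| ≤ 1` reaches a clean `σ`-degree. (the cell's LEMMA LD, engine 1 gen 31;
derived here over any commutative ring)
[cite: CossartJannsenSaito2020, Ch. 14, proof of Lemma 14.10 (p. 170) (Hasse derivations `D_A`: `G(X+ρ) = Σ_A D_A G·ρ^A`)] -/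
theorem coeff_layerSubst_of_isCleanLayer (h0 : ∀ i, (Δ i).coeff 0 = 0) {s : ℕ}
    (hs : IsCleanLayer Δ s) (g : MvPolynomial ι R) :
    (layerSubst Δ g).coeff s = (if s = 0 then g else 0) + layerDeriv Δ s g := by
  induction g using MvPolynomial.induction_on with
  | C a =>
    rw [layerSubst_C, Polynomial.coeff_C, layerDeriv_C, add_zero]
  | add p q hp hq =>
    rw [map_add, Polynomial.coeff_add, hp, hq, layerDeriv_add]
    split_ifs <;> ring
  | mul_X p j hp =>
    rw [map_mul, layerSubst_X, mul_add, Polynomial.coeff_add, Polynomial.coeff_mul_C, hp,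
      Polynomial.coeff_mul, Finset.sum_eq_single (0, s)]
    · dsimp only
      rw [coeff_zero_layerSubst Δ h0, layerDeriv_mul_X]
      split_ifs <;> ring
    · rintro ⟨a, b⟩ hab hne
      rw [Finset.mem_antidiagonal] at hab
      dsimp only at hab hne ⊢
      have ha : a ≠ 0 := by
        rintro rfl
        rw [zero_add] at hab
        exact hne (by rw [hab])
      by_contra hmul
      obtain ⟨T, hT, hTs⟩ :=
        exists_multiset_of_coeff_layerSubst_ne_zero Δ p (left_ne_zero_of_mul hmul)
      have hmem : ∀ t ∈ b ::ₘ T, IsLayerIndex Δ t := by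
        intro t ht
        rcases Multiset.mem_cons.1 ht with rfl | ht
        · exact ⟨j, right_ne_zero_of_mul hmul⟩
        · exact hT t ht
      have hcard := hs (b ::ₘ T) hmem (by rw [Multiset.sum_cons, hTs]; omega)
      rw [Multiset.card_cons] at hcard
      have hT0 : T = 0 := Multiset.card_eq_zero.1 (by omega)
      rw [hT0, Multiset.sum_zero] at hTs
      exact ha hTs.symm
    · intro h
      exact absurd (Finset.mem_antidiagonal.2 (zero_add s)) h

/-- LEMMA LD in a layer `s ≥ 1`: `c_s(g) = L_s(g)`. (derived here)
[cite: CossartJannsenSaito2020, Ch. 14, proof of Lemma 14.10 (p. 170)] -/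
theorem coeff_layerSubst_eq_layerDeriv (h0 : ∀ i, (Δ i).coeff 0 = 0) {s : ℕ} (hs : IsCleanLayer Δ s)
    (hs0 : s ≠ 0) (g : MvPolynomial ι R) : (layerSubst Δ g).coeff s = layerDeriv Δ s g := by
  rw [coeff_layerSubst_of_isCleanLayer h0 hs, if_neg hs0, zero_add]

/-- PURGE form: if `g` is `Φ`-invariant (`g(ε + Δ) = g`) then `L_s(g) = 0` in every clean layer `s ≥ 1`
(the identity behind the PURGE step of the cell's normal-form algorithm). (derived here)
[cite: CossartJannsenSaito2020, Ch. 14, proof of Lemma 14.10 (p. 170)] -/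
theorem layerDeriv_eq_zero_of_layerSubst_eq (h0 : ∀ i, (Δ i).coeff 0 = 0) {s : ℕ}
    (hs : IsCleanLayer Δ s) (hs0 : s ≠ 0) {g : MvPolynomial ι R}
    (hg : layerSubst Δ g = Polynomial.C g) : layerDeriv Δ s g = 0 := by
  rw [← coeff_layerSubst_eq_layerDeriv h0 hs hs0, hg, Polynomial.coeff_C, if_neg hs0]

/-- The difference form used by the engine: the `σ^s`-coefficient of `g(ε + Δ) − g` is `L_s(g)` for every
clean `s` (including `s = 0`, where both sides vanish). (derived here)
[cite: CossartJannsenSaito2020, Ch. 14, proof of Lemma 14.10 (p. 170)] -/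
theorem coeff_layerSubst_sub (h0 : ∀ i, (Δ i).coeff 0 = 0) {s : ℕ} (hs : IsCleanLayer Δ s)
    (g : MvPolynomial ι R) :
    (layerSubst Δ g - Polynomial.C g).coeff s = layerDeriv Δ s g := by
  rw [Polynomial.coeff_sub, coeff_layerSubst_of_isCleanLayer h0 hs, Polynomial.coeff_C]
  split_ifs <;> ring

end Main

section Clean

variable {Δ : ι → Polynomial (MvPolynomial ι R)}

/-- With no layer `0`, layer indices are positive. (plumbing, derived here)
[cite: CossartJannsenSaito2020, Ch. 14, proof of Lemma 14.10 (p. 170)] -/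
theorem IsLayerIndex.pos (h0 : ∀ i, (Δ i).coeff 0 = 0) {t : ℕ} (ht : IsLayerIndex Δ t) : 0 < t := by
  obtain ⟨i, hi⟩ := ht
  by_contra h
  obtain rfl : t = 0 := by omega
  exact hi (h0 i)

/-- Every `s` below twice the least layer index is clean ("`3, 4, 5 < 3 + 3`" in the engine's cubic-order
case). (derived here) [cite: CossartJannsenSaito2020, Ch. 14, proof of Lemma 14.10 (p. 170)] -/
theorem isCleanLayer_of_lt_two_mul {m s : ℕ} (hm : ∀ t, IsLayerIndex Δ t → m ≤ t) (hs : s < 2 * m) :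
    IsCleanLayer Δ s := by
  intro T hT hsum
  by_contra hc
  have hle : Multiset.card T • m ≤ T.sum := Multiset.card_nsmul_le_sum fun t ht => hm t (hT t ht)
  rw [smul_eq_mul, hsum] at hle
  have h2 : 2 * m ≤ Multiset.card T * m := Nat.mul_le_mul_right m (by omega)
  omega

/-- The least layer (indeed any `s ≥ 1` below every layer index) is clean. (derived here)
[cite: CossartJannsenSaito2020, Ch. 14, proof of Lemma 14.10 (p. 170)] -/
theorem isCleanLayer_of_forall_le {s : ℕ} (hmin : ∀ t, IsLayerIndex Δ t → s ≤ t) (hs : 0 < s) :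
    IsCleanLayer Δ s :=
  isCleanLayer_of_lt_two_mul hmin (by omega)

/-- `0` is clean when there is no layer `0` (only the empty multiset of layer indices sums to `0`).
(plumbing, derived here) [cite: CossartJannsenSaito2020, Ch. 14, proof of Lemma 14.10 (p. 170)] -/
theorem isCleanLayer_zero (h0 : ∀ i, (Δ i).coeff 0 = 0) : IsCleanLayer Δ 0 := by
  intro T hT hsum
  have hT0 : T = 0 := by
    by_contra hne
    obtain ⟨t, ht⟩ := Multiset.exists_mem_of_ne_zero hne
    have hpos := IsLayerIndex.pos h0 (hT t ht)
    have hle : t ≤ T.sum := Multiset.le_sum_of_mem ht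
    omega
  rw [hT0, Multiset.card_zero]
  exact Nat.zero_le 1

/-- ONE-LAYER SHIFT: for `Δ_i = σ^d · a_i` with `d ≥ 1` the `σ^d`-coefficient of `g(ε + σ^d a)` is the
directional derivative `Σ_i a_i ∂_i g` — the first-order Taylor term `Σ_{|A|=1} D_A g · ρ^A`, over any
commutative ring. (derived here)
[cite: CossartJannsenSaito2020, Ch. 14, proof of Lemma 14.10 (p. 170) (Hasse derivations `D_A`: `G(X+ρ) = Σ_A D_A G·ρ^A`)] -/
theorem coeff_layerSubst_monomial [Fintype ι] {d : ℕ} (hd : 0 < d) (a : ι → MvPolynomial ι R)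
    (g : MvPolynomial ι R) :
    (layerSubst (fun i => Polynomial.monomial d (a i)) g).coeff d = ∑ i, a i * pderiv i g := by
  have h0 : ∀ i, (Polynomial.monomial d (a i)).coeff 0 = 0 := fun i => by
    rw [Polynomial.coeff_monomial, if_neg (by omega)]
  have hmin : ∀ t, IsLayerIndex (fun i => Polynomial.monomial d (a i)) t → d ≤ t := by
    rintro t ⟨i, hi⟩
    rw [Polynomial.coeff_monomial] at hi
    by_contra h
    exact hi (if_neg (by omega))
  rw [coeff_layerSubst_eq_layerDeriv h0 (isCleanLayer_of_lt_two_mul hmin (by omega)) (by omega),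
    layerDeriv]
  simp only [Polynomial.coeff_monomial, if_pos]

end Clean

section Sharpness

/-! ### Sharpness: an unclean layer is not a derivation
For `g = ε_0 ε_1` and `Δ_0 = Δ_1 = σ` (one layer, index `1`): `g(ε + Δ) = ε_0ε_1 + σ(ε_0 + ε_1) + σ²`, so the
unclean layer `2 = 1 + 1` has `c_2(g) = 1` while `L_2(g) = 0`. -/

/-- SHARPNESS of "clean": `c_2(ε_0 ε_1) = 1` for the shift `Δ_0 = Δ_1 = σ` (the `|A| = 2` Taylor term
`D_{(1,1)}(ε_0ε_1) ρ_0 ρ_1` lands in the unclean layer `2 = 1 + 1`). (derived here)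
[cite: CossartJannsenSaito2020, Ch. 14, proof of Lemma 14.10 (p. 170)] -/
theorem coeff_two_layerSubst_X_mul_X :
    (layerSubst (fun _ : Fin 2 => (Polynomial.X : Polynomial (MvPolynomial (Fin 2) R)))
      (X 0 * X 1)).coeff 2 = 1 := by
  rw [map_mul, layerSubst_X, layerSubst_X]
  have : (Polynomial.C (X 0 : MvPolynomial (Fin 2) R) + Polynomial.X) *
      (Polynomial.C (X 1) + Polynomial.X) =
      Polynomial.X ^ 2 + Polynomial.C (X 0 + X 1) * Polynomial.X + Polynomial.C (X 0 * X 1) := by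
    rw [map_add, map_mul]; ring
  rw [this, Polynomial.coeff_add, Polynomial.coeff_add, Polynomial.coeff_X_pow, if_pos rfl,
    Polynomial.coeff_C_mul_X, if_neg (by norm_num), Polynomial.coeff_C, if_neg (by norm_num),
    add_zero, add_zero]

/-- … while `L_2(ε_0 ε_1) = 0` (the shift `Δ_0 = Δ_1 = σ` has no layer `2`). (derived here)
[cite: CossartJannsenSaito2020, Ch. 14, proof of Lemma 14.10 (p. 170)] -/
theorem layerDeriv_two_X_mul_X :
    layerDeriv (fun _ : Fin 2 => (Polynomial.X : Polynomial (MvPolynomial (Fin 2) R))) 2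
      (X 0 * X 1) = 0 := by
  simp [layerDeriv, Polynomial.coeff_X]

/-- … and `2 = 1 + 1` is indeed not a clean layer of the shift `Δ_0 = Δ_1 = σ` (over a non-trivial ring).
(derived here) [cite: CossartJannsenSaito2020, Ch. 14, proof of Lemma 14.10 (p. 170)] -/
theorem not_isCleanLayer_two [Nontrivial R] :
    ¬ IsCleanLayer (fun _ : Fin 2 => (Polynomial.X : Polynomial (MvPolynomial (Fin 2) R))) 2 := by
  intro h
  have h1 : IsLayerIndex (fun _ : Fin 2 => (Polynomial.X : Polynomial (MvPolynomial (Fin 2) R))) 1 :=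
    ⟨0, by rw [Polynomial.coeff_X_one]; exact one_ne_zero⟩
  have := h ((1 : ℕ) ::ₘ (1 : ℕ) ::ₘ 0) (fun t ht => by
    simp only [Multiset.mem_cons, Multiset.notMem_zero, or_false, or_self] at ht
    subst ht; exact h1) (by simp)
  simp at this

end Sharpness

end Literature.AlgebraicGeometry.Resolution.WeightedBlowup

end
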